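import Summits.ResolutionOfSingularities.ResolutionOfSingularities.Theorems.PAlterationPialtAtomsOpenRange
import Literature.AlgebraicGeometry.Resolution.ZariskiPatchingProperModels
import Literature.AlgebraicGeometry.Resolution.ProperModelsJoin
import Literature.AlgebraicGeometry.Resolution.AffineDomainDimension
import Literature.AlgebraicGeometry.Resolution.QuasiExcellentSchemes
import Literature.AlgebraicGeometry.Resolution.ExcellentRingsFieldProofs
import Literature.AlgebraicGeometry.Resolution.Principalization
import Mathlib.RingTheory.EssentialFiniteness
import HarnessLib

/-!
# Crux `PatchingRelPerfect` (stmt-ResolutionOfSingularities-16161), line `closed-point-slice`: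
# stub `stub_sliceOfEngine` — the dimension-`≤ 4` integral slice from LU and the roof engine

Route `ResolutionOfSingularities/FrobeniusClosing`, crux #6 `PatchingRelPerfect`. This file proves
the registered stub `stub_sliceOfEngine` of the line `closed-point-slice` (skeleton v2.1), verbatim
(`PrintedInputs → RelLUPerfect p → RoofEngine p → ResPerfectIntegralDimLeFour p`): for `k` perfect
of characteristic `p` and an integral separated `k`-scheme of finite type `X` of dimension `≤ 4`,
`X` has a resolution of singularities — given Cossart–Piltant's theorem in dimension `≤ 3` (`hG`),
relative local uniformization over perfect fields of characteristic `p` (`hLU`) and the ROOF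
ENGINE (`hR`: an integral separated finite-type `k`-scheme of dimension `4` with a regular roof at
every closed point has a resolution).

## Proof (Zariski's setup; Piltant 2013, Prop. 5.1 and Cor. 5.7, with the join in place of the
patching)

* Reduction to integral closed subschemes `X ⊆ ℙⁿ_k` (`ResolutionOverUpToDim.of_projective`:
  components, Chow's lemma, projective closure).
* An affine chart `Spec A ∋ η` of `X`, `K = Frac A`, `X` as a projective model `M₀` of `K/k`
  (`ProjModel.ofChart`); `trdeg_k K = dim X` (`properModel_topologicalKrullDim_eq_of_trdeg`,
  `exists_ringKrullDim_eq_and_trdeg_eq`). If `dim X ≤ 3`: Cossart–Piltant. Else `trdeg_k K = 4`.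
* (LU) at `k, K` in the fibrewise shape gives a finite resolving system `𝒯` of affine models
  (`exists_hasRegularCentre_of_relLU`, `exists_finite_resolvingSystem'`), pushed to proper models
  `M_T` (`ProjModel.exists_regCentre_of_hasRegularCentre`, `ProjModel.toProperModel`).
* The iterated JOIN `N` of `M₀` with the `M_T` (`ProperModel.join`; `exists_hom_forall_nonempty_hom`)
  dominates `M₀` and every `M_T`; `dim N = dim M_T = trdeg_k K = 4`.
* ROOFS: every point `m ∈ N` is the centre of a valuation ring `v` of `K/k`
  (`KModel.exists_isCentre_of_isGenericPoint`), regularly centred on some `M_T`; the domination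
  `q : N → M_T` maps `m` to the centre of `v` on `M_T` (`ProperModel.Hom.map_centre`), a regular
  point; `q` is proper and birational (`ProperModel.Hom.isProper`, `ProperModel.Hom.isBirational`).
* The roof engine resolves `N`; transfer along the proper birational `N → M₀ = X`
  (`Scheme.HasResolution.of_isBirational`).

## Sources

* O. Zariski, *Reduction of the singularities of algebraic three dimensional varieties*, Ann. of
  Math. 45 (1944) 472–542, Fundamental Theorem p. 539. [Zariski1944]
* O. Piltant, *An axiomatic version of Zariski's patching theorem*, RACSAM 107 (2013) 91–121,
  Prop. 5.1 and Cor. 5.7. [Piltant2013]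
* V. Cossart, O. Piltant, J. Algebra 529 (2019), Thm. 1.1. [CossartPiltant2019]
-/

set_option linter.dupNamespace false -- single-problem summit: doubled namespace component is forced

noncomputable section

open CategoryTheory CategoryTheory.Limits AlgebraicGeometry Literature.AlgebraicGeometry.Resolution
open Literature.AlgebraicGeometry (Motives.projectiveSpace Motives.isProper_projectiveSpace
  Motives.IsProjectiveOver)
open TopologicalSpace IsLocalRing

namespace Summit.ResolutionOfSingularities.ResolutionOfSingularities.Theorems

namespace PatchingRelPerfect.SliceOfEngine

variable {k K : Type} [Field k] [Field K] [Algebra k K]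

/-- **The iterated join**: a proper model `M₀` and a finite list of proper models of `K/k` are all
dominated by ONE proper model (induction on the list: join the model found so far with the next
member, `ProperModel.join`, `joinFst`, `joinSnd`). [cite: Piltant2013, Prop. 5.1 (proof, Step 2)] -/
theorem exists_hom_forall_nonempty_hom (M₀ : ProperModel k K) :
    ∀ l : List (ProperModel k K), ∃ (N : ProperModel k K) (_ : N.Hom M₀),
      ∀ M ∈ l, Nonempty (N.Hom M)
  | [] => ⟨M₀, ProperModel.Hom.id M₀, fun M hM => by simp at hM⟩
  | M :: l => by
    obtain ⟨N, φ, hN⟩ := exists_hom_forall_nonempty_hom M₀ l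
    refine ⟨ProperModel.join N M, (ProperModel.joinFst N M).comp φ, fun M' hM' => ?_⟩
    rcases List.mem_cons.mp hM' with h | hl
    · subst h
      exact ⟨ProperModel.joinSnd N M'⟩
    · obtain ⟨ψ⟩ := hN M' hl
      exact ⟨(ProperModel.joinFst N M).comp ψ⟩

/-- **Pointwise regular roofs on a model dominating a resolving system**: if the proper model `N`
of `K/k`, `trdeg_k K = 4`, dominates every member of a finite list of proper models on SOME member
of which every valuation ring of `K/k` has a regular centre, then every point `m ∈ N` has a
regular roof: `m` is the centre of a valuation ring `v` (`KModel.exists_isCentre_of_isGenericPoint`),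
regularly centred on some member `M`, and the domination `q : N → M` (proper, birational) maps `m`
to the centre of `v` on `M` (`ProperModel.Hom.map_centre`); `dim M = trdeg_k K = 4`.
[cite: Piltant2013, Prop. 5.1 and Cor. 5.7] -/
theorem exists_roof (N : ProperModel k K) (hK : Algebra.trdeg k K = ((4 : ℕ) : Cardinal))
    (l : List (ProperModel k K)) (hhom : ∀ M ∈ l, Nonempty (N.Hom M))
    (hcov : ∀ v : ZariskiRiemannSpace k K, ∃ M ∈ l, M.RegCentre v) (m : N.X) :
    ∃ (N' : Scheme.{0}) (gN : N' ⟶ Spec (.of k)) (q : N.X ⟶ N'),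
      IsSeparated gN ∧ LocallyOfFiniteType gN ∧ QuasiCompact gN ∧ IsIntegral N' ∧
      q ≫ gN = N.π ∧ IsProper q ∧ IsBirational q ∧ topologicalKrullDim N' ≤ 4 ∧
      IsRegularLocalRing (N'.presheaf.stalk (q.base m)) := by
  -- `m` is the centre of some valuation ring `v` of `K/k`
  have hgen : IsGenericPoint N.toKModel.genericPt (Set.univ : Set N.X) := by
    rw [N.genericPt_eq']
    exact genericPoint_spec N.X
  obtain ⟨v, hv⟩ := N.toKModel.exists_isCentre_of_isGenericPoint hgen m
  -- `v` has a regular centre on some member `M`, dominated by `N`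
  obtain ⟨M, hMl, hMv⟩ := hcov v
  obtain ⟨φ⟩ := hhom M hMl
  have hm : φ.f.base m = M.centre v := by
    rw [ProperModel.eq_centre_of_isCentre hv]
    exact φ.map_centre v
  have hdimM : topologicalKrullDim M.X ≤ 4 := by
    rw [Pialt.OpenRange.properModel_topologicalKrullDim_eq_of_trdeg M hK]
    exact le_of_eq (by rfl)
  refine ⟨M.X, M.π, φ.f, inferInstance, inferInstance, inferInstance, inferInstance, φ.f_π,
    inferInstance, φ.isBirational, hdimM, ?_⟩
  rw [hm]
  exact hMv

/-- **The projective integral case of the slice.** For a field `k` with relative local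
uniformization over `k` (fibrewise shape `hLU`) and the roof engine over `k` (`hR`), every
integral closed subscheme `X ⊆ ℙⁿ_k` of dimension `≤ 4` has a resolution of singularities,
modulo `CossartPiltant2019` (dimension `≤ 3`). Zariski's setup verbatim
(`hasResolution_of_properPatching_of_relLU`): affine chart `Spec A ∋ η`, `K = Frac A`, `X` as the
projective model `M₀ = ProjModel.ofChart …`, `trdeg_k K = dim X`; a finite resolving system of
proper models from (LU); then — instead of patching — the iterated join `N` of `M₀` with the
system has regular roofs at all points (`exists_roof`), the roof engine resolves `N`, and the
resolution descends along the proper birational domination `N → X`.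
[cite: Piltant2013, Prop. 5.1 and Cor. 5.7; Zariski1944, p. 539] -/
theorem hasResolution_projective_of_dim_le_four (hCP : CossartPiltant2019.{0}) {k : Type}
    [Field k]
    (hLU : ∀ (K : Type) [Field K] [Algebra k K] (O : ValuationSubring K) (R : Subalgebra k K),
      R.FG → IsFractionRing R K → R.toSubring ≤ O.toSubring →
        ∃ (A : Subalgebra k K) (h : A.toSubring ≤ O.toSubring), R ≤ A ∧ A.FG ∧
          IsRegularLocalRing (Localization.AtPrime
            (Ideal.comap (Subring.inclusion h) (IsLocalRing.maximalIdeal O))))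
    (hR : ∀ (M : Scheme.{0}) (g : M ⟶ Spec (.of k)) [IsSeparated g] [LocallyOfFiniteType g]
      [QuasiCompact g] [IsIntegral M], topologicalKrullDim M = 4 →
      (∀ m : M, IsClosed ({m} : Set M) →
        ∃ (N : Scheme.{0}) (gN : N ⟶ Spec (.of k)) (q : M ⟶ N),
          IsSeparated gN ∧ LocallyOfFiniteType gN ∧ QuasiCompact gN ∧ IsIntegral N ∧
          q ≫ gN = g ∧ IsProper q ∧ IsBirational q ∧ topologicalKrullDim N ≤ 4 ∧
          IsRegularLocalRing (N.presheaf.stalk (q.base m))) →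
      Scheme.HasResolution M)
    {n : ℕ} (X : Scheme.{0}) [IsIntegral X] (ι : X ⟶ (Motives.projectiveSpace n k).left)
    [IsClosedImmersion ι] (hX : topologicalKrullDim X ≤ ((4 : ℕ) : WithBot ℕ∞)) :
    Scheme.HasResolution X := by
  classical
  haveI : IsProper (Motives.projectiveSpace n k).hom := Motives.isProper_projectiveSpace n k
  let πX : X ⟶ Spec (.of k) := ι ≫ (Motives.projectiveSpace n k).hom
  have hproj : Motives.IsProjectiveOver (Over.mk πX) := ⟨n, Over.homMk ι rfl, ‹_›⟩
  haveI : LocallyOfFiniteType πX := inferInstance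
  -- an affine chart `U = Spec A` of `X`
  obtain ⟨_, ⟨U', hU', rfl⟩, hηU, -⟩ := X.isBasis_affineOpens.exists_subset_of_mem_open
    (Set.mem_univ (genericPoint X)) isOpen_univ
  let U : X.Opens := U'
  have hU : IsAffineOpen U := hU'
  haveI : IsAffine U := hU
  haveI : Nonempty U := ⟨⟨_, hηU⟩⟩
  let A : Type := Γ(U, ⊤)
  -- `A` is a finitely generated `k`-algebra
  let g : (U : Scheme.{0}) ⟶ Spec (.of k) := U.ι ≫ πX
  let ψ : k →+* A := g.appTop.hom.comp (Scheme.ΓSpecIso (.of k)).inv.hom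
  have hψ : ψ.FiniteType := by
    have h1 : g.appTop.hom.FiniteType :=
      (HasRingHomProperty.iff_of_isAffine (P := @LocallyOfFiniteType)).mp inferInstance
    exact h1.comp (RingHom.FiniteType.of_surjective _
      (Scheme.ΓSpecIso (.of k)).symm.commRingCatIsoToRingEquiv.surjective)
  letI : Algebra k A := ψ.toAlgebra
  haveI hft : Algebra.FiniteType k A := hψ
  -- its fraction field `K`, and `X` as a projective model of `K/k`
  let K : Type := FractionRing A
  let j : Spec (.of A) ⟶ X := U.toScheme.isoSpec.inv ≫ U.ι
  have hj : j ≫ πX = Spec.map (CommRingCat.ofHom (algebraMap k A)) := by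
    change (U.toScheme.isoSpec.inv ≫ U.ι) ≫ πX = Spec.map (CommRingCat.ofHom ψ)
    rw [Category.assoc, isoSpec_inv_comp]
    rfl
  let M₀ : ProjModel k K := ProjModel.ofChart (K := K) X πX hproj A j hj
  -- `A` as a subalgebra `A₀ ⊆ K`, finitely generated with `Frac A₀ = K`
  let toK : A →ₐ[k] K := IsScalarTower.toAlgHom k A K
  let A₀ : Subalgebra k K := toK.range
  have hA₀fg : A₀.FG := by
    rw [show A₀ = Subalgebra.map toK ⊤ from (Algebra.map_top toK).symm]
    exact Subalgebra.FG.map toK hft.out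
  haveI hA₀fr : IsFractionRing A₀ K := by
    refine IsFractionRing.of_field A₀ K fun z => ?_
    obtain ⟨a, b, -, rfl⟩ := IsFractionRing.div_surjective (A := A) z
    exact ⟨⟨algebraMap A K a, a, rfl⟩, ⟨algebraMap A K b, b, rfl⟩, rfl⟩
  -- `trdeg_k K` is a natural number `m`, and `dim X = m`
  haveI : Algebra.FiniteType k A₀ := A₀.fg_iff_finiteType.mp hA₀fg
  obtain ⟨m, -, htrA₀⟩ := exists_ringKrullDim_eq_and_trdeg_eq k A₀
  have hKm : Algebra.trdeg k K = m := (trdeg_eq_trdeg_of_isFractionRing A₀).trans htrA₀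
  have hXm : topologicalKrullDim X = m :=
    Pialt.OpenRange.properModel_topologicalKrullDim_eq_of_trdeg M₀.toProperModel hKm
  by_cases hm3 : m ≤ 3
  · -- dimension `≤ 3`: Cossart–Piltant
    have h3 : topologicalKrullDim X ≤ 3 := by
      rw [hXm]
      exact_mod_cast hm3
    exact hCP k X πX inferInstance inferInstance inferInstance inferInstance h3
  -- dimension `4`
  have hm4 : m ≤ 4 := by
    have h : (m : WithBot ℕ∞) ≤ ((4 : ℕ) : WithBot ℕ∞) := hXm ▸ hX
    exact_mod_cast h
  have hm : m = 4 := by omega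
  subst hm
  -- a finite resolving system of affine models, from (LU)
  have hcov : ∀ v : ZariskiRiemannSpace k K, ∃ T : Subalgebra k K,
      (T.FG ∧ IsFractionRing T K) ∧ ZariskiRiemannSpace.HasRegularCentre T v :=
    fun v => exists_hasRegularCentre_of_relLU (hLU K) A₀ hA₀fg v
  obtain ⟨𝒯, h𝒯, h𝒯cov⟩ := exists_finite_resolvingSystem' (P := fun T => IsFractionRing T K)
    (fun T hT => (isJ2Ring_of_field k).2 T ((Subalgebra.fg_iff_finiteType T).mp hT)) hcov
  -- their projective closures, as PROPER models: a finite resolving system of proper models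
  have hM : ∀ T : ↥𝒯, ∃ M : ProperModel k K, ∀ w : ZariskiRiemannSpace k K,
      ZariskiRiemannSpace.HasRegularCentre T.1 w → M.RegCentre w := fun T => by
    haveI := (h𝒯 T.1 T.2).2
    obtain ⟨M, hM⟩ := ProjModel.exists_regCentre_of_hasRegularCentre T.1 (h𝒯 T.1 T.2).1
    exact ⟨M.toProperModel, fun w hw => (M.toProperModel_regCentre_iff w).mpr (hM w hw)⟩
  choose M hM using hM
  let l : List (ProperModel k K) := 𝒯.attach.toList.map M
  have hlcov : ∀ v : ZariskiRiemannSpace k K, ∃ N ∈ l, N.RegCentre v := by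
    intro v
    obtain ⟨T, hT, hTv⟩ := h𝒯cov v
    refine ⟨M ⟨T, hT⟩, ?_, hM ⟨T, hT⟩ v hTv⟩
    exact List.mem_map.mpr ⟨⟨T, hT⟩, Finset.mem_toList.mpr (Finset.mem_attach _ _), rfl⟩
  -- the iterated join of `M₀` with the resolving system
  obtain ⟨N, φ₀, hN⟩ := exists_hom_forall_nonempty_hom M₀.toProperModel l
  -- `N` is an integral proper `k`-scheme of dimension `4` with regular roofs: the engine resolves it
  have hdimN : topologicalKrullDim N.X = 4 := by
    rw [Pialt.OpenRange.properModel_topologicalKrullDim_eq_of_trdeg N hKm]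
    rfl
  have hresN : Scheme.HasResolution N.X :=
    hR N.X N.π hdimN fun x _ => exists_roof N hKm l hN hlcov x
  -- transfer to `X = M₀.X` along the proper birational domination `N → M₀`
  have hres₀ : Scheme.HasResolution M₀.toProperModel.X :=
    Scheme.HasResolution.of_isBirational φ₀.f φ₀.isBirational hresN
  exact hres₀

end PatchingRelPerfect.SliceOfEngine

open PatchingRelPerfect.SliceOfEngine in
/-- **STUB `stub_sliceOfEngine` — the dimension-`≤ 4` integral slice from LU and the roof engine
(= `PrintedInputs → RelLUPerfect p → RoofEngine p → ResPerfectIntegralDimLeFour p`, registered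
signature verbatim).** For `k` perfect of characteristic `p` and an integral separated `k`-scheme of
finite type `X` with `dim X ≤ 4`, `X` has a resolution of singularities, given Cossart–Piltant in
dimension `≤ 3` (`hG`, with `Stacks07QW_field_holds`), relative LU over perfect fields of
characteristic `p` (`hLU`, reshaped fibrewise at `k` as in
`resolutionInChar_of_properTwoModelPatching_of_relLU`) and the roof engine (`hR`). Reduction to
integral closed subschemes of `ℙⁿ_k` (`ResolutionOverUpToDim.of_projective`), then
`hasResolution_projective_of_dim_le_four` (finite resolving system from LU, iterated join,
pointwise regular roofs, engine, birational transfer). The principalization input `hP` is idle.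
[cite: Piltant2013, Prop. 5.1 and Cor. 5.7; Zariski1944, p. 539; CossartPiltant2019, Thm. 1.1] -/
theorem stub_sliceOfEngine (p : ℕ) (hp : p.Prime)
    (hG : CossartPiltant2019General.{0}) (hP : CossartPiltant2019Principalization.{0})
    (hLU : ∀ (k K : Type) [Field k] [CharP k p] [PerfectField k] [Field K] [Algebra k K],
      (⊤ : IntermediateField k K).FG → ∀ O : ValuationSubring K, (∀ c : k, algebraMap k K c ∈ O) →
        ∀ R : Subalgebra k K, R.FG → R.toSubring ≤ O.toSubring →
          ∃ (A : Subalgebra k K) (h : A.toSubring ≤ O.toSubring), R ≤ A ∧ A.FG ∧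
            IsFractionRing A K ∧ IsRegularLocalRing (Localization.AtPrime
              (Ideal.comap (Subring.inclusion h) (IsLocalRing.maximalIdeal O))))
    (hR : ∀ (k : Type) [Field k] [CharP k p] [PerfectField k] (M : Scheme.{0})
      (g : M ⟶ Spec (.of k)) [IsSeparated g] [LocallyOfFiniteType g] [QuasiCompact g] [IsIntegral M],
      topologicalKrullDim M = 4 →
      (∀ m : M, IsClosed ({m} : Set M) →
        ∃ (N : Scheme.{0}) (gN : N ⟶ Spec (.of k)) (q : M ⟶ N),
          IsSeparated gN ∧ LocallyOfFiniteType gN ∧ QuasiCompact gN ∧ IsIntegral N ∧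
          q ≫ gN = g ∧ IsProper q ∧ IsBirational q ∧ topologicalKrullDim N ≤ 4 ∧
          IsRegularLocalRing (N.presheaf.stalk (q.base m))) →
      Scheme.HasResolution M)
    (k : Type) [Field k] [CharP k p] [PerfectField k] (X : Scheme.{0}) (f : X ⟶ Spec (.of k))
    [IsSeparated f] [LocallyOfFiniteType f] [QuasiCompact f] [IsIntegral X]
    (hX : topologicalKrullDim X ≤ 4) : Scheme.HasResolution X := by
  have _ := hp
  have _ := hP
  have hCP : CossartPiltant2019.{0} := hG.cossartPiltant2019 Stacks07QW_field_holds
  -- (LU) at `k`, in the fibrewise shape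
  have hLU' : ∀ (K : Type) [Field K] [Algebra k K] (O : ValuationSubring K) (R : Subalgebra k K),
      R.FG → IsFractionRing R K → R.toSubring ≤ O.toSubring →
        ∃ (A : Subalgebra k K) (h : A.toSubring ≤ O.toSubring), R ≤ A ∧ A.FG ∧
          IsRegularLocalRing (Localization.AtPrime
            (Ideal.comap (Subring.inclusion h) (IsLocalRing.maximalIdeal O))) := by
    intro K _ _ O R hRfg hRfr hRO
    haveI : Algebra.FiniteType k R := R.fg_iff_finiteType.mp hRfg
    haveI : Algebra.EssFiniteType R K :=
      Algebra.EssFiniteType.of_isLocalization K (nonZeroDivisors R)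
    have hKfg : (⊤ : IntermediateField k K).FG :=
      IntermediateField.fg_top_iff.mpr (Algebra.EssFiniteType.comp k R K)
    obtain ⟨A, h, hle, hAfg, -, hreg⟩ :=
      hLU k K hKfg O (fun c => hRO (R.algebraMap_mem c)) R hRfg hRO
    exact ⟨A, h, hle, hAfg, hreg⟩
  -- weak resolution over `k` up to dimension `4`, by reduction to the projective integral case
  have h4 : ResolutionOverUpToDim k 4 :=
    ResolutionOverUpToDim.of_projective fun n Y ι hι hint hY => by
      haveI := hι
      haveI := hint
      exact hasResolution_projective_of_dim_le_four hCP hLU' (hR k) Y ι hY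
  exact h4 X f ‹_› ‹_› ‹_› inferInstance (by exact_mod_cast hX)

end Summit.ResolutionOfSingularities.ResolutionOfSingularities.Theorems

end
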